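import Summits.HodgeConjecture.HodgeConjecture.Theorems.EightfoldBlochSeedsChernCharacterOnBettiAnalytificationHom
import Summits.HodgeConjecture.HodgeConjecture.Theorems.EightfoldBlochSeedsChernCharacterOnBettiAnalytificationRank
import Literature.AlgebraicGeometry.Modules.DeterminantCocycleExact
import HarnessLib

/-!
# K1 (analytification bridge), towards K1f: a short exact sequence of vector bundles analytifies to a
# fibrewise SHORT EXACT sequence of topological bundle maps `0 → F₁(ℂ) → F₂(ℂ) → F₃(ℂ) → 0`

Route `EightfoldBlochSeeds` / item `stmt-HodgeConjecture-19780` (`ChernCharacterOnBetti`), helper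
(`--supports`). HONEST FRAMING: nothing here proves 19780 / 18880 / 18882 / 18883 / H2 / HC_AV / HC;
no definition, no named fact.

WHAT. For a short exact sequence `S : 0 → F₁ → F₂ → F₃ → 0` of `𝒪_X`-modules with `F₁`, `F₃` finite
locally free and analytification data `(Eᵢ, αᵢ)` of the `Fᵢ` (steps 2–4), the bundle maps
`u = f^an : E₁ → E₂`, `v = g^an : E₂ → E₃` of `exists_bundleMap_of_comparison_hom` (GAGA functoriality)
form, on every fibre, a short exact sequence of `ℂ`-vector spaces: `u_P` injective, `v_P` surjective,
`range u_P = ker v_P` (`exists_bundleMaps_shortExact_of_comparison`). The algebra is read in the tree's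
ADAPTED FRAMES (`Modules/AdaptedFrame`, `Modules/DeterminantCocycleExact`: near each point `F₂` is framed
by the images of a frame of `F₁` together with lifts of a frame of `F₃`), carried to fibre bases by `α₂`.
This is the first half of the field `ch_shortExact` of `ChernCharacterBetti` (Serre, GAGA §3 n°10:
`F ↦ F^h` is exact); the second half — a short exact sequence of topological bundles over a paracompact
base splits, so `c(E₂) = c(E₁) c(E₃)` (Whitney) — is NOT here (census K1f).

[cite: SerreGAGA1956, §3 n°9 Déf. 2, Prop. 10] [cite: Hartshorne1977, II Ex. 5.7 (b)]
-/

noncomputable section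

-- single-problem summit (Problem = Summit): the mandated namespace repeats `HodgeConjecture`.
set_option linter.dupNamespace false

open CategoryTheory AlgebraicGeometry Bundle Topology
open Literature.AlgebraicGeometry.Motives Literature.AlgebraicGeometry.HodgeTheory Literature.AlgebraicGeometry.Modules
open Literature.AlgebraicTopology.SingularHomology Literature.AlgebraicTopology.CharacteristicClasses

namespace Summit.HodgeConjecture.HodgeConjecture.Theorems

variable {X : SchemeOver ℂ} {S : ShortComplex X.left.Modules} {r₁ r₂ r₃ : ℕ}

/-- **`0 → F₁(ℂ) → F₂(ℂ) → F₃(ℂ) → 0` is fibrewise short exact.** For a short exact sequence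
`S : 0 → F₁ → F₂ → F₃ → 0` of `𝒪_X`-modules with `F₁`, `F₃` finite locally free and data `(Eᵢ, αᵢ)` of
the `Fᵢ` (frames of sizes `rᵢ` near every point), there are continuous fibrewise-linear bundle maps
`u : E₁ → E₂`, `v : E₂ → E₃` with `u(α₁ σ) = α₂(f σ)`, `v(α₂ σ) = α₃(g σ)`, and on every fibre `u_P` is
injective, `v_P` is surjective and `range u_P = ker v_P`.
[cite: SerreGAGA1956, §3 n°9 Déf. 2 and Prop. 10] [cite: Hartshorne1977, II Ex. 5.7 (b)] -/
theorem exists_bundleMaps_shortExact_of_comparison (hS : S.ShortExact)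
    (h₁ : IsFiniteLocallyFree S.X₁) (h₃ : IsFiniteLocallyFree S.X₃)
    (hF₁ : ∀ x : X.left, ∃ (U : X.left.Opens) (s : Fin r₁ → Γ(S.X₁, U)), x ∈ U ∧ IsSectionFrame S.X₁ U s)
    (hF₂ : ∀ x : X.left, ∃ (U : X.left.Opens) (s : Fin r₂ → Γ(S.X₂, U)), x ∈ U ∧ IsSectionFrame S.X₂ U s)
    (hF₃ : ∀ x : X.left, ∃ (U : X.left.Opens) (s : Fin r₃ → Γ(S.X₃, U)), x ∈ U ∧ IsSectionFrame S.X₃ U s)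
    (E₁ E₂ E₃ : ComplexVectorBundle.{0, 0} (ComplexPoints X))
    (α₁ : ∀ U : X.left.Opens, Γ(S.X₁, U) → ∀ P : ComplexPoints X, E₁.E P)
    (α₂ : ∀ U : X.left.Opens, Γ(S.X₂, U) → ∀ P : ComplexPoints X, E₂.E P)
    (α₃ : ∀ U : X.left.Opens, Γ(S.X₃, U) → ∀ P : ComplexPoints X, E₃.E P)
    (hadd₁ : ∀ (U : X.left.Opens) (σ τ : Γ(S.X₁, U)) (P : ComplexPoints X), α₁ U (σ + τ) P = α₁ U σ P + α₁ U τ P)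
    (hsmul₁ : ∀ (U : X.left.Opens) (f : Γ(X.left, U)) (σ : Γ(S.X₁, U)) (P : ComplexPoints X) (h : P.pt ∈ U),
      α₁ U (f • σ) P = P.eval U h f • α₁ U σ P)
    (hres₁ : ∀ (U W : X.left.Opens) (hWU : W ≤ U) (σ : Γ(S.X₁, U)) (P : ComplexPoints X), P.pt ∈ W →
      α₁ W (S.X₁.presheaf.map (homOfLE hWU).op σ) P = α₁ U σ P)
    (hcont₁ : ∀ (U : X.left.Opens) (σ : Γ(S.X₁, U)),
      ContinuousOn (fun P ↦ (⟨P, α₁ U σ P⟩ : TotalSpace E₁.F E₁.E)) {P | P.pt ∈ U})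
    (hframe₁ : ∀ (U : X.left.Opens) (t : Fin r₁ → Γ(S.X₁, U)), IsSectionFrame S.X₁ U t →
      ∀ P : ComplexPoints X, P.pt ∈ U → LinearIndependent ℂ (fun j ↦ α₁ U (t j) P) ∧
        ⊤ ≤ Submodule.span ℂ (Set.range fun j ↦ α₁ U (t j) P))
    (hadd₂ : ∀ (U : X.left.Opens) (σ τ : Γ(S.X₂, U)) (P : ComplexPoints X), α₂ U (σ + τ) P = α₂ U σ P + α₂ U τ P)
    (hsmul₂ : ∀ (U : X.left.Opens) (f : Γ(X.left, U)) (σ : Γ(S.X₂, U)) (P : ComplexPoints X) (h : P.pt ∈ U),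
      α₂ U (f • σ) P = P.eval U h f • α₂ U σ P)
    (hres₂ : ∀ (U W : X.left.Opens) (hWU : W ≤ U) (σ : Γ(S.X₂, U)) (P : ComplexPoints X), P.pt ∈ W →
      α₂ W (S.X₂.presheaf.map (homOfLE hWU).op σ) P = α₂ U σ P)
    (hcont₂ : ∀ (U : X.left.Opens) (σ : Γ(S.X₂, U)),
      ContinuousOn (fun P ↦ (⟨P, α₂ U σ P⟩ : TotalSpace E₂.F E₂.E)) {P | P.pt ∈ U})
    (hframe₂ : ∀ (U : X.left.Opens) (t : Fin r₂ → Γ(S.X₂, U)), IsSectionFrame S.X₂ U t →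
      ∀ P : ComplexPoints X, P.pt ∈ U → LinearIndependent ℂ (fun j ↦ α₂ U (t j) P) ∧
        ⊤ ≤ Submodule.span ℂ (Set.range fun j ↦ α₂ U (t j) P))
    (hadd₃ : ∀ (U : X.left.Opens) (σ τ : Γ(S.X₃, U)) (P : ComplexPoints X), α₃ U (σ + τ) P = α₃ U σ P + α₃ U τ P)
    (hsmul₃ : ∀ (U : X.left.Opens) (f : Γ(X.left, U)) (σ : Γ(S.X₃, U)) (P : ComplexPoints X) (h : P.pt ∈ U),
      α₃ U (f • σ) P = P.eval U h f • α₃ U σ P)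
    (hres₃ : ∀ (U W : X.left.Opens) (hWU : W ≤ U) (σ : Γ(S.X₃, U)) (P : ComplexPoints X), P.pt ∈ W →
      α₃ W (S.X₃.presheaf.map (homOfLE hWU).op σ) P = α₃ U σ P)
    (hcont₃ : ∀ (U : X.left.Opens) (σ : Γ(S.X₃, U)),
      ContinuousOn (fun P ↦ (⟨P, α₃ U σ P⟩ : TotalSpace E₃.F E₃.E)) {P | P.pt ∈ U})
    (hframe₃ : ∀ (U : X.left.Opens) (t : Fin r₃ → Γ(S.X₃, U)), IsSectionFrame S.X₃ U t →
      ∀ P : ComplexPoints X, P.pt ∈ U → LinearIndependent ℂ (fun j ↦ α₃ U (t j) P) ∧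
        ⊤ ≤ Submodule.span ℂ (Set.range fun j ↦ α₃ U (t j) P)) :
    ∃ (u : ∀ P : ComplexPoints X, E₁.E P →ₗ[ℂ] E₂.E P) (v : ∀ P : ComplexPoints X, E₂.E P →ₗ[ℂ] E₃.E P),
      (∀ (U : X.left.Opens) (σ : Γ(S.X₁, U)) (P : ComplexPoints X), P.pt ∈ U → u P (α₁ U σ P) = α₂ U (S.f.app U σ) P) ∧
      (∀ (U : X.left.Opens) (σ : Γ(S.X₂, U)) (P : ComplexPoints X), P.pt ∈ U → v P (α₂ U σ P) = α₃ U (S.g.app U σ) P) ∧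
      Continuous (fun q : TotalSpace E₁.F E₁.E ↦ (⟨q.proj, u q.proj q.2⟩ : TotalSpace E₂.F E₂.E)) ∧
      Continuous (fun q : TotalSpace E₂.F E₂.E ↦ (⟨q.proj, v q.proj q.2⟩ : TotalSpace E₃.F E₃.E)) ∧
      (∀ P : ComplexPoints X, Function.Injective (u P) ∧ Function.Surjective (v P) ∧
        LinearMap.range (u P) = LinearMap.ker (v P)) := by
  classical
  letI : ∀ P : ComplexPoints X, AddCommGroup (E₁.E P) := fun P ↦ Module.addCommMonoidToAddCommGroup ℂ
  letI : ∀ P : ComplexPoints X, AddCommGroup (E₂.E P) := fun P ↦ Module.addCommMonoidToAddCommGroup ℂ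
  letI : ∀ P : ComplexPoints X, AddCommGroup (E₃.E P) := fun P ↦ Module.addCommMonoidToAddCommGroup ℂ
  obtain ⟨u, hu, hcu⟩ := exists_bundleMap_of_comparison_hom S.f hF₁ E₁ E₂ α₁ α₂ hadd₁ hsmul₁ hres₁ hcont₁ hframe₁
    hadd₂ hsmul₂ hres₂ hcont₂
  obtain ⟨v, hv, hcv⟩ := exists_bundleMap_of_comparison_hom S.g hF₂ E₂ E₃ α₂ α₃ hadd₂ hsmul₂ hres₂ hcont₂ hframe₂
    hadd₃ hsmul₃ hres₃ hcont₃
  refine ⟨u, v, hu, hv, hcu, hcv, fun P ↦ ?_⟩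
  -- the adapted frame at `x = P.pt`
  set x := P.pt with hxdef
  set W := adaptedOpen hS h₁ h₃ x with hWdef
  have hPW : P.pt ∈ W := mem_adaptedOpen hS h₁ h₃ x
  set e₁ := frame₁ hS h₁ h₃ x
  set e₃ := frame₃ hS h₁ h₃ x
  set eA := adaptedFrame hS e₁ e₃ (adaptedLift hS h₁ h₃ x) (adaptedLift_spec hS h₁ h₃ x)
  -- index bookkeeping: `|I₁| = r₁`, `|I₃| = r₃`, `|I₁| + |I₃| = r₂`
  have hc₁ : Fintype.card (TrivIndex h₁ x) = r₁ := by
    obtain ⟨U, s, hxU, hs⟩ := hF₁ x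
    exact frame_card_eq (isSectionFrame_basisSection e₁ (Fintype.equivFin _)) hs hPW hxU
  have hc₃ : Fintype.card (TrivIndex h₃ x) = r₃ := by
    obtain ⟨U, s, hxU, hs⟩ := hF₃ x
    exact frame_card_eq (isSectionFrame_basisSection e₃ (Fintype.equivFin _)) hs hPW hxU
  have hc₂ : Fintype.card (TrivIndex h₁ x ⊕ TrivIndex h₃ x) = r₂ := by
    obtain ⟨U, s, hxU, hs⟩ := hF₂ x
    exact frame_card_eq (isSectionFrame_basisSection (E := S.X₂) eA (Fintype.equivFin _)) hs hPW hxU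
  let ε₁ : TrivIndex h₁ x ≃ Fin r₁ := (Fintype.equivFin _).trans (finCongr hc₁)
  let ε₃ : TrivIndex h₃ x ≃ Fin r₃ := (Fintype.equivFin _).trans (finCongr hc₃)
  let εA : TrivIndex h₁ x ⊕ TrivIndex h₃ x ≃ Fin r₂ := (Fintype.equivFin _).trans (finCongr hc₂)
  -- fibre bases at `P`
  obtain ⟨hli₁, hsp₁⟩ := hframe₁ W _ (isSectionFrame_basisSection e₁ ε₁) P hPW
  obtain ⟨hliA, hspA⟩ := hframe₂ W _ (isSectionFrame_basisSection (E := S.X₂) eA εA) P hPW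
  obtain ⟨hli₃, hsp₃⟩ := hframe₃ W _ (isSectionFrame_basisSection e₃ ε₃) P hPW
  -- `u` on the frame of `E₁`: the `inl`-part of the adapted frame
  have hu_inl : ∀ i : TrivIndex h₁ x, u P (α₁ W (basisSection e₁ i) P) =
      α₂ W (basisSection (E := S.X₂) eA (Sum.inl i)) P := by
    intro i
    rw [hu W _ P hPW, basisSection_adaptedFrame_inl]
  -- `v` on the adapted frame: `inl ↦ 0`, `inr k ↦ α₃(b³_k)`
  have hv_inl : ∀ i : TrivIndex h₁ x, v P (α₂ W (basisSection (E := S.X₂) eA (Sum.inl i)) P) = 0 := by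
    intro i
    rw [basisSection_adaptedFrame_inl, hv W _ P hPW, g_app_f_app]
    have h0 := hadd₃ W 0 0 P
    rw [add_zero] at h0
    exact left_eq_add.mp h0
  have hv_inr : ∀ k : TrivIndex h₃ x, v P (α₂ W (basisSection (E := S.X₂) eA (Sum.inr k)) P) =
      α₃ W (basisSection e₃ k) P := by
    intro k
    rw [basisSection_adaptedFrame_inr, hv W _ P hPW, adaptedLift_spec]
  -- reindexed forms of the frames at `P` (index types `I₁`, `I₁ ⊕ I₃`, `I₃`)
  let g₁ : TrivIndex h₁ x → E₁.E P := fun i ↦ α₁ W (basisSection e₁ i) P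
  let gA : TrivIndex h₁ x ⊕ TrivIndex h₃ x → E₂.E P := fun t ↦ α₂ W (basisSection (E := S.X₂) eA t) P
  let g₃ : TrivIndex h₃ x → E₃.E P := fun k ↦ α₃ W (basisSection e₃ k) P
  have hli₁' : LinearIndependent ℂ g₁ := (linearIndependent_equiv ε₁.symm).1 hli₁
  have hliA' : LinearIndependent ℂ gA := (linearIndependent_equiv εA.symm).1 hliA
  have hli₃' : LinearIndependent ℂ g₃ := (linearIndependent_equiv ε₃.symm).1 hli₃
  have hsp₁' : ⊤ ≤ Submodule.span ℂ (Set.range g₁) := by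
    rw [← ε₁.symm.surjective.range_comp g₁]; exact hsp₁
  have hspA' : ⊤ ≤ Submodule.span ℂ (Set.range gA) := by
    rw [← εA.symm.surjective.range_comp gA]; exact hspA
  have hsp₃' : ⊤ ≤ Submodule.span ℂ (Set.range g₃) := by
    rw [← ε₃.symm.surjective.range_comp g₃]; exact hsp₃
  let b₁ : Module.Basis (TrivIndex h₁ x) ℂ (E₁.E P) := Module.Basis.mk hli₁' hsp₁'
  let bA : Module.Basis (TrivIndex h₁ x ⊕ TrivIndex h₃ x) ℂ (E₂.E P) := Module.Basis.mk hliA' hspA'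
  let b₃ : Module.Basis (TrivIndex h₃ x) ℂ (E₃.E P) := Module.Basis.mk hli₃' hsp₃'
  haveI : Module.Finite ℂ (E₁.E P) := Module.Finite.of_basis b₁
  haveI : Module.Finite ℂ (E₂.E P) := Module.Finite.of_basis bA
  haveI : Module.Finite ℂ (E₃.E P) := Module.Finite.of_basis b₃
  have hb₁ : ∀ i, b₁ i = g₁ i := fun i ↦ Module.Basis.mk_apply _ _ i
  have hbA : ∀ t, bA t = gA t := fun t ↦ Module.Basis.mk_apply _ _ t
  have hb₃ : ∀ k, b₃ k = g₃ k := fun k ↦ Module.Basis.mk_apply _ _ k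
  -- `u` is injective: it carries the basis `b₁` to the `inl`-part of the basis `bA`
  have hinj : Function.Injective (u P) := by
    refine (injective_iff_map_eq_zero _).2 fun w hw ↦ ?_
    have hrepr := b₁.sum_repr w
    have hsum : ∑ i, b₁.repr w i • gA (Sum.inl i) = 0 := by
      have h := congrArg (u P) hrepr
      rw [hw, map_sum] at h
      rw [← h]
      refine Finset.sum_congr rfl fun i _ ↦ ?_
      rw [map_smul, hb₁]
      exact congrArg _ (hu_inl i).symm
    have hc := Fintype.linearIndependent_iff.1 (hliA'.comp Sum.inl Sum.inl_injective) (fun i ↦ b₁.repr w i) hsum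
    rw [← hrepr]
    exact Finset.sum_eq_zero fun i _ ↦ by rw [hc i, zero_smul]
  -- `v` is surjective: its range contains the basis `b₃`
  have hsurj : Function.Surjective (v P) := by
    rw [← LinearMap.range_eq_top, eq_top_iff]
    refine hsp₃'.trans (Submodule.span_le.2 ?_)
    rintro _ ⟨k, rfl⟩
    exact ⟨gA (Sum.inr k), hv_inr k⟩
  -- `v ∘ u = 0`
  have hcomp : (v P).comp (u P) = 0 := by
    refine b₁.ext fun i ↦ ?_
    rw [LinearMap.comp_apply, hb₁, LinearMap.zero_apply]
    change v P (u P (α₁ W (basisSection e₁ i) P)) = 0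
    rw [hu_inl, hv_inl]
  refine ⟨hinj, hsurj, ?_⟩
  -- `range u = ker v` by a dimension count
  refine Submodule.eq_of_le_of_finrank_eq (LinearMap.range_le_ker_iff.2 hcomp) ?_
  have hr₁ : Module.finrank ℂ (LinearMap.range (u P)) = Fintype.card (TrivIndex h₁ x) := by
    rw [LinearMap.finrank_range_of_inj hinj, Module.finrank_eq_card_basis b₁]
  have hrk := (v P).finrank_range_add_finrank_ker
  rw [LinearMap.range_eq_top.2 hsurj, finrank_top, Module.finrank_eq_card_basis b₃, Module.finrank_eq_card_basis bA,
    Fintype.card_sum] at hrk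
  rw [hr₁]
  omega

end Summit.HodgeConjecture.HodgeConjecture.Theorems

end
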